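import Summits.AtomisticToContinuum.Crystallization.Theorems.OverbindingBudgetAffineWildCutA

/-!
# NODE g99 «WildCut» (lens-4) — part B: the census algebra, the PROVED seams, the second level (wild at tolerance `θ₁`) and the record literals

Part A (`…AffineWildCutA`) types the five cells of the wild population and proves the counting (cover + weaker side) and the cell «AbsorbedWild».
This file proves the SEAMS (0 sorry):

§1 census algebra: `censusW_of_le_mul_add` (domination with a REAL multiple of the rebate — the form the depth half `notDeepCount_depth_le` delivers),
   `censusW_add`.
§2 THE CUT of the target `W(ρ₁) := TameBalancedWildRunGap 64 ρ₁ (1/10⁴) (1/1000) (3/50) (1/450) 12 2` (= `WildRun` / `WildRunWide` / `WildRunWide30`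
   at `ρ₁ = 12 / 24 / 30`):   **W(ρ₁) ⟺ MildShear ρ₁ L θ₁ ∧ HaloWild ρ₁ L θ₁ ∧ StrainCore ρ₁ L θ₁ ∧ RoughCore ρ₁ L θ₁**   for every depth `L ≥ 0` and
   every `θ₁` («AbsorbedWild» PROVED in part A and dropped; `⟸` = cover + depth + glue, `⟹` = sub-population).
§3 THE SECOND LEVEL: the wild leaf AT TOLERANCE `θ₁ ≥ 10⁻³`, `W(ρ₁, θ₁) := TameBalancedWildRunGap 64 ρ₁ (1/10⁴) θ₁ …`, satisfies
   **W(ρ₁, θ₁) ⟺ HaloWild ∧ StrainCore ∧ RoughCore** — «MildShear» is exactly what the looser tolerance removes from the wild class; it reappears as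
   rigid-or-compressed matter OF THE SAME SWAP at tolerance `θ₁`: `MildShear_W ⟸ RigidRun_W(ρ₁, θ₁) ∧ CompressedRun_W(ρ₁, θ₁)`.
§4 the compressed leaf at tolerance `θ₁`: **CompressedRun_W(ρ₁, θ₁) ⟸ KD♭_W [PROVED] ⊕ CompressedMild_W** («CompressedMild» = compressed, `θ₁`-smooth,
   not absorbable: g79's site-slack engine re-run at tolerance `θ₁` — ATTACKABLE-M; and `CompressedMild_W ⟸ W_W(ρ₁)` for `ρ₁ ≥ 12`: WEAKER than the target).
§5 seams to the record: `RunInterior ⟸ SW♭(ρ₁, θ₁) ∧ CompressedMild ∧ HaloWild ∧ StrainCore ∧ RoughCore` (tree `balancedRunInteriorGapW_of_swapFlatW`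
   at `θ₀ := θ₁`, BY NAME), `InterfaceDominance ⟸ … ∧ ThinFault`, RDEF through `rdef_of_ceg_shape_roughCut_record` BY NAME; the record-radius forms
   `WildRun ⟺ MildShear 12 ∧ StrainCore 12 ∧ RoughCore 12` (halo EMPTY at `ρ₁ = 12`), `WildRunWide`, `WildRunWide30`; the instance of record proposed:
   `(ρ₁, θ₁, L) = (30, 1/400, 64)`.

TAGS (census grammar).  «AbsorbedWild» WEAKER · PROVED.  «MildShear» WEAKER · INSTRUMENTABLE/ATTACKABLE-L (swap on the strain box; new literal of the
EXISTING parametric competitor `TameStackSwapGainFlat 64 ρ₁ (1/10⁴) θ₁ (17/50) (17/20) (3/50) (1/450) 12 2` — an additional leaf, NOT a re-dial of the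
(2c) record).  «CompressedMild» WEAKER (than W and than RO(ρ₁, θ₁)) · ATTACKABLE-M.  «HaloWild» WEAKER (than W and than `RigidRun`) · ATTACKABLE-L ·
INSTRUMENTABLE.  «StrainCore» WEAKER · IDEA-NEEDED.  «RoughCore» WEAKER · IDEA-NEEDED · INSTRUMENTABLE.  Residual of record after this node:
**StrainCore ∧ RoughCore** (each a strict sub-population of W at extra depth `L`; converses MUST-FAIL, probes `HOME/…/g99/bc/`).
-/

namespace Summit.AtomisticToContinuum.Crystallization.Theorems.OverbindingBudgetAffineWildCut

open scoped BigOperators Classical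
open Literature.MathematicalPhysics.StatisticalMechanics
open Literature.Geometry.DiscreteGeometry (IsChargeFree nearestDist nearestDist_nonneg nearestDist_le_dist)
open Summit.AtomisticToContinuum.Crystallization.Theorems.OverbindingBudgetMisfitRegistration (Framed Reg DeepReg)
open Summit.AtomisticToContinuum.Crystallization.Theorems.OverbindingBudgetMisfitWindowStatements (InWindow offCount)
open Summit.AtomisticToContinuum.Crystallization.Theorems.OverbindingBudgetBalancedCensusStatements
open Summit.AtomisticToContinuum.Crystallization.Theorems.OverbindingBudgetAffineLadder
open Summit.AtomisticToContinuum.Crystallization.Theorems.OverbindingBudgetAffineMesoCut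
open Summit.AtomisticToContinuum.Crystallization.Theorems.OverbindingBudgetAffinePhaseCut
open Summit.AtomisticToContinuum.Crystallization.Theorems.OverbindingBudgetAffineCushionCut
open Summit.AtomisticToContinuum.Crystallization.Theorems.OverbindingBudgetAffineTwinCut
open Summit.AtomisticToContinuum.Crystallization.Theorems.OverbindingBudgetAffineRunCut
open Summit.AtomisticToContinuum.Crystallization.Theorems.OverbindingBudgetAffineCompressedCut
open Summit.AtomisticToContinuum.Crystallization.Theorems.OverbindingBudgetAffineCompressedCutInner (nearFieldSlackMinSecond_record)
open Summit.AtomisticToContinuum.Crystallization.Theorems.OverbindingBudgetAffineRunCutFlat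

variable {N : ℕ}

/-! ## §1  Census algebra -/

/-- **Census domination with a real multiple of the rebate**: if `R ≤ A + K·D + #off` pointwise on injective configurations (`K ≥ 0` real), a census of
`A` against `D` is a census of `R` against `D` (same rate `c`, constant `max C 0 + c·(K+1)`). [this file] -/
theorem censusW_of_le_mul_add {A R D : ∀ {N : ℕ}, (Fin N → EuclideanSpace ℝ (Fin 3)) → ℕ} {σ₁ σ₂ K : ℝ} (hK : 0 ≤ K)
    (hR : ∀ {N : ℕ} (y : Fin N → EuclideanSpace ℝ (Fin 3)), Function.Injective y → (R y : ℝ) ≤ A y + K * D y + offCount σ₁ σ₂ y)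
    (h : CensusW A D σ₁ σ₂) : CensusW R D σ₁ σ₂ := by
  obtain ⟨c, C, hc, h⟩ := h
  set P : ℝ := max C 0 with hP
  have hP0 : 0 ≤ P := le_max_right _ _
  have hCP : C ≤ P := le_max_left _ _
  refine ⟨c, P + c * (K + 1), hc, fun N y hy => ?_⟩
  obtain ⟨u, hu, e⟩ := h N y hy
  refine ⟨u, hu, ?_⟩
  have hRy := hR y hy
  have n3 : (0 : ℝ) ≤ D y := Nat.cast_nonneg _
  have n5 : (0 : ℝ) ≤ offCount σ₁ σ₂ y := Nat.cast_nonneg _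
  have n6 : (0 : ℝ) ≤ (N : ℝ) ^ (2 / 3 : ℝ) := Real.rpow_nonneg (Nat.cast_nonneg _) _
  have g1 : 0 ≤ dilGain y + shGain u y := add_nonneg (dilGain_nonneg y) (shGain_nonneg _ y)
  have e' : (N : ℝ) * (⨅ Q : PeriodicConfiguration 3, Q.energyPerParticle lennardJones) + c * (A y : ℝ)
      - P * (D y : ℝ) - P * (offCount σ₁ σ₂ y : ℝ) - P * (N : ℝ) ^ (2 / 3 : ℝ) - P * (dilGain y + shGain u y)
      ≤ interactionEnergy lennardJones y := by
    linarith [mul_le_mul_of_nonneg_right hCP n3, mul_le_mul_of_nonneg_right hCP n5, mul_le_mul_of_nonneg_right hCP n6,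
      mul_le_mul_of_nonneg_right hCP g1]
  have step : c * (R y : ℝ) ≤ c * A y + c * K * D y + c * offCount σ₁ σ₂ y := by
    have := mul_le_mul_of_nonneg_left hRy hc.le
    linarith
  have hcK : 0 ≤ c * K := mul_nonneg hc.le hK
  linarith [mul_nonneg hc.le n3, mul_nonneg hcK n5, mul_nonneg hcK n6, mul_nonneg hc.le n6, mul_nonneg hcK g1, mul_nonneg hc.le g1]

/-- Two censuses against the same rebate price the sum of their counts (`censusW_glue` with `D₁ = D`). [tree, BY NAME] -/
theorem censusW_add {A B D : ∀ {N : ℕ}, (Fin N → EuclideanSpace ℝ (Fin 3)) → ℕ} {σ₁ σ₂ : ℝ} (hA : CensusW A D σ₁ σ₂) (hB : CensusW B D σ₁ σ₂) :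
    CensusW (fun y => A y + B y) D σ₁ σ₂ :=
  censusW_glue (R := fun y => A y + B y) (fun _ => le_rfl) (fun _ => Nat.le_add_right _ _) hA hB

/-! ## §2  THE CUT: W(ρ₁) ⟺ MildShear ∧ HaloWild ∧ StrainCore ∧ RoughCore («AbsorbedWild» proved) -/

/-- **GLUE (one window)**: the five cells (with «AbsorbedWild» as a hypothesis) give `W_W(ρ₁)` — cover `wildRunCount_le_cells`, depth `notDeepCount_depth_le`
(g74, BY NAME), `censusW_glue`. [this file] -/
theorem balancedWildRunGapW_of_cells {ρ₁ L θ₁ σ₁ σ₂ : ℝ} (hL : 0 ≤ L) (hσ : 0 < σ₁) (hσσ : σ₁ ≤ σ₂)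
    (hA : AbsorbedWildW ρ₁ σ₁ σ₂) (hM : MildShearW ρ₁ L θ₁ σ₁ σ₂) (hH : HaloWildW ρ₁ L θ₁ σ₁ σ₂) (hS : StrainCoreW ρ₁ L θ₁ σ₁ σ₂)
    (hR : RoughCoreW ρ₁ L θ₁ σ₁ σ₂) : BalancedWildRunGapW 64 ρ₁ (1 / 10 ^ 4) (1 / 1000) (3 / 50) (1 / 450) 12 2 σ₁ σ₂ := by
  have h5 : CensusW (fun y => absorbedWildCount ρ₁ y + mildShearCount ρ₁ L θ₁ y + haloWildCount ρ₁ L θ₁ y + strainCoreCount ρ₁ L θ₁ y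
      + roughCoreCount ρ₁ L θ₁ y) (fun y => notDeepCount 64 (3 / 50) (1 / 450) y) σ₁ σ₂ :=
    censusW_add (censusW_add (censusW_add (censusW_add hA hM) hH) hS) hR
  set K : ℝ := 27 / σ₁ ^ 3 * (2 * L * σ₂ + σ₁) ^ 3 with hK
  have hb : 0 ≤ 2 * L * σ₂ + σ₁ := by nlinarith [mul_nonneg hL (hσ.le.trans hσσ)]
  have hK0 : 0 ≤ K := by rw [hK]; exact mul_nonneg (div_nonneg (by norm_num) (pow_nonneg hσ.le 3)) (pow_nonneg hb 3)
  refine balancedWildRunGapW_iff_censusW.2 (censusW_of_le_mul_add (K := K) hK0 (fun y hy => ?_) h5)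
  have h1 : ((wildRunCount 64 ρ₁ (1 / 10 ^ 4) (1 / 1000) (3 / 50) (1 / 450) 12 2 y : ℕ) : ℝ) ≤
      ((absorbedWildCount ρ₁ y + mildShearCount ρ₁ L θ₁ y + haloWildCount ρ₁ L θ₁ y + strainCoreCount ρ₁ L θ₁ y + roughCoreCount ρ₁ L θ₁ y : ℕ) : ℝ)
        + (notDeepCount L (3 / 50) (1 / 450) y : ℝ) := by
    exact_mod_cast wildRunCount_le_cells ρ₁ L θ₁ y
  have h2 : (notDeepCount L (3 / 50) (1 / 450) y : ℝ) ≤ K * notDeepCount 64 (3 / 50) (1 / 450) y + offCount σ₁ σ₂ y := by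
    rw [hK]; exact notDeepCount_depth_le (by norm_num) hL hσ hσσ hy
  linarith

/-- **W(ρ₁) from its four open cells** («AbsorbedWild» discharged by `absorbedWildW_record`), any depth `L ≥ 0`, any `θ₁`. [this file] -/
theorem tameBalancedWildRunGap_of_cells {ρ₁ L θ₁ : ℝ} (hL : 0 ≤ L) (hM : MildShear ρ₁ L θ₁) (hH : HaloWild ρ₁ L θ₁) (hS : StrainCore ρ₁ L θ₁)
    (hR : RoughCore ρ₁ L θ₁) : TameBalancedWildRunGap 64 ρ₁ (1 / 10 ^ 4) (1 / 1000) (3 / 50) (1 / 450) 12 2 :=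
  fun δ hδ hδ2 => balancedWildRunGapW_of_cells hL hδ hδ2 (absorbedWildW_record ρ₁ hδ hδ2) (hM δ hδ hδ2) (hH δ hδ hδ2) (hS δ hδ hδ2) (hR δ hδ hδ2)

/-- WEAKER side: `W_W(ρ₁) ⇒` each cell (sub-population, `censusW_mono` BY NAME). [this file] -/
theorem cells_of_balancedWildRunGapW {ρ₁ L θ₁ σ₁ σ₂ : ℝ} (h : BalancedWildRunGapW 64 ρ₁ (1 / 10 ^ 4) (1 / 1000) (3 / 50) (1 / 450) 12 2 σ₁ σ₂) :
    AbsorbedWildW ρ₁ σ₁ σ₂ ∧ MildShearW ρ₁ L θ₁ σ₁ σ₂ ∧ HaloWildW ρ₁ L θ₁ σ₁ σ₂ ∧ StrainCoreW ρ₁ L θ₁ σ₁ σ₂ ∧ RoughCoreW ρ₁ L θ₁ σ₁ σ₂ := by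
  have hc := balancedWildRunGapW_iff_censusW.1 h
  exact ⟨censusW_mono (fun y => absorbedWildCount_le ρ₁ y) (fun _ => le_rfl) hc,
    censusW_mono (fun y => mildShearCount_le ρ₁ L θ₁ y) (fun _ => le_rfl) hc, censusW_mono (fun y => haloWildCount_le ρ₁ L θ₁ y) (fun _ => le_rfl) hc,
    censusW_mono (fun y => strainCoreCount_le ρ₁ L θ₁ y) (fun _ => le_rfl) hc, censusW_mono (fun y => roughCoreCount_le ρ₁ L θ₁ y) (fun _ => le_rfl) hc⟩

/-- **THE CUT (lossless): `W(ρ₁) ⟺ MildShear ∧ HaloWild ∧ StrainCore ∧ RoughCore`**, every depth `L ≥ 0`, every shear tolerance `θ₁`. [this file] -/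
theorem tameBalancedWildRunGap_iff_cells {ρ₁ L θ₁ : ℝ} (hL : 0 ≤ L) :
    TameBalancedWildRunGap 64 ρ₁ (1 / 10 ^ 4) (1 / 1000) (3 / 50) (1 / 450) 12 2 ↔
      MildShear ρ₁ L θ₁ ∧ HaloWild ρ₁ L θ₁ ∧ StrainCore ρ₁ L θ₁ ∧ RoughCore ρ₁ L θ₁ :=
  ⟨fun h => ⟨fun δ hδ hδ2 => (cells_of_balancedWildRunGapW (h δ hδ hδ2)).2.1, fun δ hδ hδ2 => (cells_of_balancedWildRunGapW (h δ hδ hδ2)).2.2.1,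
      fun δ hδ hδ2 => (cells_of_balancedWildRunGapW (h δ hδ hδ2)).2.2.2.1, fun δ hδ hδ2 => (cells_of_balancedWildRunGapW (h δ hδ hδ2)).2.2.2.2⟩,
    fun h => tameBalancedWildRunGap_of_cells hL h.1 h.2.1 h.2.2.1 h.2.2.2⟩

/-! ## §3  THE SECOND LEVEL: the wild leaf at tolerance `θ₁ ≥ 10⁻³` is `HaloWild ∧ StrainCore ∧ RoughCore`; «MildShear» is swap matter at tolerance `θ₁` -/

/-- **GLUE at tolerance θ₁ (one window)**: «AbsorbedWild» ∧ «HaloWild» ∧ «StrainCore» ∧ «RoughCore» give `W_W(ρ₁, θ₁)`. [this file] -/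
theorem balancedWildRunGapW_tol_of_cells {ρ₁ L θ₁ σ₁ σ₂ : ℝ} (hL : 0 ≤ L) (hθ : (1 / 1000 : ℝ) ≤ θ₁) (hσ : 0 < σ₁) (hσσ : σ₁ ≤ σ₂)
    (hA : AbsorbedWildW ρ₁ σ₁ σ₂) (hH : HaloWildW ρ₁ L θ₁ σ₁ σ₂) (hS : StrainCoreW ρ₁ L θ₁ σ₁ σ₂) (hR : RoughCoreW ρ₁ L θ₁ σ₁ σ₂) :
    BalancedWildRunGapW 64 ρ₁ (1 / 10 ^ 4) θ₁ (3 / 50) (1 / 450) 12 2 σ₁ σ₂ := by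
  have h4 : CensusW (fun y => absorbedWildCount ρ₁ y + haloWildCount ρ₁ L θ₁ y + strainCoreCount ρ₁ L θ₁ y + roughCoreCount ρ₁ L θ₁ y)
      (fun y => notDeepCount 64 (3 / 50) (1 / 450) y) σ₁ σ₂ :=
    censusW_add (censusW_add (censusW_add hA hH) hS) hR
  set K : ℝ := 27 / σ₁ ^ 3 * (2 * L * σ₂ + σ₁) ^ 3 with hK
  have hb : 0 ≤ 2 * L * σ₂ + σ₁ := by nlinarith [mul_nonneg hL (hσ.le.trans hσσ)]
  have hK0 : 0 ≤ K := by rw [hK]; exact mul_nonneg (div_nonneg (by norm_num) (pow_nonneg hσ.le 3)) (pow_nonneg hb 3)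
  refine balancedWildRunGapW_iff_censusW.2 (censusW_of_le_mul_add (K := K) hK0 (fun y hy => ?_) h4)
  have h1 : ((wildRunCount 64 ρ₁ (1 / 10 ^ 4) θ₁ (3 / 50) (1 / 450) 12 2 y : ℕ) : ℝ) ≤
      ((absorbedWildCount ρ₁ y + haloWildCount ρ₁ L θ₁ y + strainCoreCount ρ₁ L θ₁ y + roughCoreCount ρ₁ L θ₁ y : ℕ) : ℝ)
        + (notDeepCount L (3 / 50) (1 / 450) y : ℝ) := by
    exact_mod_cast wildRunCount_tol_le_cells hθ y
  have h2 : (notDeepCount L (3 / 50) (1 / 450) y : ℝ) ≤ K * notDeepCount 64 (3 / 50) (1 / 450) y + offCount σ₁ σ₂ y := by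
    rw [hK]; exact notDeepCount_depth_le (by norm_num) hL hσ hσσ hy
  linarith

/-- **`W(ρ₁, θ₁) ⟺ HaloWild ∧ StrainCore ∧ RoughCore`** for `θ₁ ≥ 10⁻³`, `L ≥ 0` (weaker side: `…_le_tol` of part A). [this file] -/
theorem tameBalancedWildRunGap_tol_iff_cells {ρ₁ L θ₁ : ℝ} (hL : 0 ≤ L) (hθ : (1 / 1000 : ℝ) ≤ θ₁) :
    TameBalancedWildRunGap 64 ρ₁ (1 / 10 ^ 4) θ₁ (3 / 50) (1 / 450) 12 2 ↔ HaloWild ρ₁ L θ₁ ∧ StrainCore ρ₁ L θ₁ ∧ RoughCore ρ₁ L θ₁ := by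
  refine ⟨fun h => ⟨fun δ hδ hδ2 => ?_, fun δ hδ hδ2 => ?_, fun δ hδ hδ2 => ?_⟩, fun h δ hδ hδ2 =>
    balancedWildRunGapW_tol_of_cells hL hθ hδ hδ2 (absorbedWildW_record ρ₁ hδ hδ2) (h.1 δ hδ hδ2) (h.2.1 δ hδ hδ2) (h.2.2 δ hδ hδ2)⟩
  · exact censusW_mono (fun y => haloWildCount_le_tol ρ₁ L θ₁ y) (fun _ => le_rfl) (balancedWildRunGapW_iff_censusW.1 (h δ hδ hδ2))
  · exact censusW_mono (fun y => strainCoreCount_le_tol ρ₁ L θ₁ y) (fun _ => le_rfl) (balancedWildRunGapW_iff_censusW.1 (h δ hδ hδ2))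
  · exact censusW_mono (fun y => roughCoreCount_le_tol ρ₁ L θ₁ y) (fun _ => le_rfl) (balancedWildRunGapW_iff_censusW.1 (h δ hδ hδ2))

/-- Counting: a «MildShear» site is a RIGID (`17/20 ≤ nn`) or a COMPRESSED (`nn < 17/20`) run-interior site of the swap AT TOLERANCE `θ₁`. [this file] -/
theorem mildShearCount_le_rigid_add_compressed (ρ₁ L θ₁ : ℝ) (y : Fin N → EuclideanSpace ℝ (Fin 3)) :
    mildShearCount ρ₁ L θ₁ y ≤ rigidRunCount 64 ρ₁ (1 / 10 ^ 4) θ₁ (17 / 20) (3 / 50) (1 / 450) 12 2 y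
      + compressedRunCount 64 ρ₁ (1 / 10 ^ 4) θ₁ (17 / 20) (3 / 50) (1 / 450) 12 2 y :=
  natCard_le_add_of_imp fun j hj => by
    by_cases hs : (17 / 20 : ℝ) ≤ nearestDist y j
    · exact Or.inl ⟨hj.1.1, hj.2.2, hs⟩
    · exact Or.inr ⟨hj.1.1, hj.2.2, lt_of_not_ge hs⟩

/-- **«MildShear_W» ⟸ RigidRun_W(ρ₁, θ₁) ∧ CompressedRun_W(ρ₁, θ₁)** — the mild-shear cell IS swap matter at tolerance `θ₁`. [this file] -/
theorem mildShearW_of_rigid_compressed {ρ₁ L θ₁ σ₁ σ₂ : ℝ} (hRR : BalancedRigidRunGapW 64 ρ₁ (1 / 10 ^ 4) θ₁ (17 / 20) (3 / 50) (1 / 450) 12 2 σ₁ σ₂)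
    (hO : BalancedCompressedRunGapW 64 ρ₁ (1 / 10 ^ 4) θ₁ (17 / 20) (3 / 50) (1 / 450) 12 2 σ₁ σ₂) : MildShearW ρ₁ L θ₁ σ₁ σ₂ :=
  censusW_glue (fun y => mildShearCount_le_rigid_add_compressed ρ₁ L θ₁ y) (fun _ => Nat.le_add_right _ _)
    (balancedRigidRunGapW_iff_censusW.1 hRR) (balancedCompressedRunGapW_iff_censusW.1 hO)

/-- **«HaloWild_W» ⟸ RigidRun_W of record** (radius `12`, tolerance `10⁻³`): a halo site is a rigid run interior of the radius-`12` swap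
(`haloWildCount_le_rigidRun`), whence `HaloWild ⟸ RigidRun ⟸ RigidRunExchange ∧ CompressedRun [PROVED] ∧ WildRun` (tree `rigidRun_of_exchange`). [this file] -/
theorem haloWildW_of_rigidRun {ρ₁ L θ₁ σ₁ σ₂ : ℝ}
    (hRR : BalancedRigidRunGapW 64 12 (1 / 10 ^ 4) (1 / 1000) (17 / 20) (3 / 50) (1 / 450) 12 2 σ₁ σ₂) : HaloWildW ρ₁ L θ₁ σ₁ σ₂ :=
  censusW_mono (fun y => haloWildCount_le_rigidRun ρ₁ L θ₁ y) (fun _ => le_rfl) (balancedRigidRunGapW_iff_censusW.1 hRR)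

/-- `HaloWild ρ₁ L θ₁ ⟸ RigidRun` (the record's rigid leaf at radius 12), hence `⟸ StackSwapGain ∧ WildRun` by `rigidRun_of_exchange`,
`rigidRunExchange_of_stackSwapGain`, `compressedRun_record` BY NAME. [this file] -/
theorem haloWild_of_rigidRun {ρ₁ L θ₁ : ℝ} (hRR : RigidRun) : HaloWild ρ₁ L θ₁ :=
  fun δ hδ hδ2 => haloWildW_of_rigidRun (hRR δ hδ hδ2)

/-! ## §4  The compressed leaf at tolerance `θ₁`: KD♭ [PROVED] ⊕ «CompressedMild» -/

/-- Cell «CompressedMild»: a COMPRESSED (`nn < 17/20`) run-interior site whose `ρ₁·nn`-ball is `(1/10⁴, θ₁)`-smooth and which is NOT absorbable (so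
`17/50 ≤ nn` and its `12·nn`-ball is not `(1/10⁴, 1/1000)`-rigid): compressed smooth SHEARED matter — g79's site-slack engine at tolerance `θ₁`. -/
noncomputable def compressedMildCount (ρ₁ θ₁ : ℝ) (y : Fin N → EuclideanSpace ℝ (Fin 3)) : ℕ :=
  Nat.card {j // (((CFramed (3 / 50) (1 / 450) y j ∧ ∃ i : Fin N, DeepReg 64 (3 / 50) (1 / 450) y i ∧ dist (y j) (y i) ≤ 12 * nearestDist y i ∧
      HNear 12 (3 / 50) (1 / 450) y i) ∧ ¬ HNear 2 (3 / 50) (1 / 450) y j) ∧ (AffDeepReg ρ₁ (1 / 10 ^ 4) θ₁ (1 / 450) y j ∧ nearestDist y j < 17 / 20))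
    ∧ ¬ Absorbable y j}

/-- «CompressedMild_W» (one window). [this file · kind: statement · WEAKER than W_W(ρ₁) (ρ₁ ≥ 12) and than CompressedRun_W(ρ₁, θ₁) · ATTACKABLE-M] -/
def CompressedMildW (ρ₁ θ₁ σ₁ σ₂ : ℝ) : Prop :=
  CensusW (fun y => compressedMildCount ρ₁ θ₁ y) (fun y => notDeepCount 64 (3 / 50) (1 / 450) y) σ₁ σ₂

/-- «CompressedMild» (tame). -/
def CompressedMild (ρ₁ θ₁ : ℝ) : Prop :=
  ∀ δ : ℝ, 0 < δ → δ ≤ 2 → CompressedMildW ρ₁ θ₁ δ 2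

/-- Counting: `#compressedRun(ρ₁, θ₁) ≤ (#priced + #compressedMild) + #{not 64-deep} + #off`. [this file] -/
theorem compressedRunCount_tol_le (ρ₁ θ₁ δ : ℝ) (y : Fin N → EuclideanSpace ℝ (Fin 3)) :
    compressedRunCount 64 ρ₁ (1 / 10 ^ 4) θ₁ (17 / 20) (3 / 50) (1 / 450) 12 2 y ≤
      (pricedCount 64 12 (1 / 10 ^ 4) (1 / 1000) (17 / 50) (17 / 20) (3 / 50) (1 / 450) δ y + compressedMildCount ρ₁ θ₁ y)
        + notDeepCount 64 (3 / 50) (1 / 450) y + offCount δ 2 y := by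
  have s1 : compressedRunCount 64 ρ₁ (1 / 10 ^ 4) θ₁ (17 / 20) (3 / 50) (1 / 450) 12 2 y ≤
      compressedMildCount ρ₁ θ₁ y + Nat.card {j : Fin N // Absorbable y j} :=
    natCard_le_add_of_imp fun j hj => by
      by_cases hA : Absorbable y j
      · exact Or.inr hA
      · exact Or.inl ⟨hj, hA⟩
  have s2 : Nat.card {j : Fin N // Absorbable y j} ≤
      Nat.card {j : Fin N // Priced 64 12 (1 / 10 ^ 4) (1 / 1000) (17 / 50) (17 / 20) (3 / 50) (1 / 450) δ y j ∨
          ¬ DeepReg 64 (3 / 50) (1 / 450) y j} + Nat.card {j : Fin N // ¬ InWindow δ 2 y j} :=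
    natCard_le_add_of_imp fun j hj => by
      by_cases hW : InWindow δ 2 y j
      · by_cases hD : DeepReg 64 (3 / 50) (1 / 450) y j
        · exact Or.inl (Or.inl ⟨⟨hD, hW⟩, hj⟩)
        · exact Or.inl (Or.inr hD)
      · exact Or.inr hW
  have s3 : Nat.card {j : Fin N // Priced 64 12 (1 / 10 ^ 4) (1 / 1000) (17 / 50) (17 / 20) (3 / 50) (1 / 450) δ y j ∨
        ¬ DeepReg 64 (3 / 50) (1 / 450) y j} ≤
      pricedCount 64 12 (1 / 10 ^ 4) (1 / 1000) (17 / 50) (17 / 20) (3 / 50) (1 / 450) δ y + notDeepCount 64 (3 / 50) (1 / 450) y :=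
    natCard_le_add_of_imp fun j hj => hj
  have s4 : Nat.card {j : Fin N // ¬ InWindow δ 2 y j} = offCount δ 2 y := rfl
  omega

/-- **CompressedRun_W(ρ₁, θ₁) ⟸ «CompressedMild_W»** (KD♭_W discharged by `compressedDeepAt_min`). [this file] -/
theorem balancedCompressedRunGapW_tol_of_mild {ρ₁ θ₁ δ : ℝ} (hδ : 0 < δ) (hδ2 : δ ≤ 2) (hM : CompressedMildW ρ₁ θ₁ δ 2) :
    BalancedCompressedRunGapW 64 ρ₁ (1 / 10 ^ 4) θ₁ (17 / 20) (3 / 50) (1 / 450) 12 2 δ 2 := by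
  have hK : CensusW (fun y => pricedCount 64 12 (1 / 10 ^ 4) (1 / 1000) (17 / 50) (17 / 20) (3 / 50) (1 / 450) δ y)
      (fun y => notDeepCount 64 (3 / 50) (1 / 450) y) δ 2 := compressedDeepAt_min hδ hδ2
  have h2 : CensusW (fun y => pricedCount 64 12 (1 / 10 ^ 4) (1 / 1000) (17 / 50) (17 / 20) (3 / 50) (1 / 450) δ y + compressedMildCount ρ₁ θ₁ y)
      (fun y => notDeepCount 64 (3 / 50) (1 / 450) y) δ 2 := censusW_add hK hM
  exact balancedCompressedRunGapW_iff_censusW.2 (censusW_of_le_add (fun y => compressedRunCount_tol_le ρ₁ θ₁ δ y) h2)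

/-- `#compressedMild ≤ #compressedRun(ρ₁, θ₁)`. [this file] -/
theorem compressedMildCount_le (ρ₁ θ₁ : ℝ) (y : Fin N → EuclideanSpace ℝ (Fin 3)) :
    compressedMildCount ρ₁ θ₁ y ≤ compressedRunCount 64 ρ₁ (1 / 10 ^ 4) θ₁ (17 / 20) (3 / 50) (1 / 450) 12 2 y :=
  natCard_le_of_imp fun _ hj => hj.1

/-- WEAKER side: «CompressedMild_W» ⟸ CompressedRun_W(ρ₁, θ₁). [this file] -/
theorem compressedMildW_of_compressed {ρ₁ θ₁ σ₁ σ₂ : ℝ} (hO : BalancedCompressedRunGapW 64 ρ₁ (1 / 10 ^ 4) θ₁ (17 / 20) (3 / 50) (1 / 450) 12 2 σ₁ σ₂) :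
    CompressedMildW ρ₁ θ₁ σ₁ σ₂ :=
  censusW_mono (fun y => compressedMildCount_le ρ₁ θ₁ y) (fun _ => le_rfl) (balancedCompressedRunGapW_iff_censusW.1 hO)

/-- A «CompressedMild» site is WILD at radius `ρ₁ ≥ 12` (not absorbable and compressed ⇒ not `(12, 1/10⁴, 1/1000)`-deep ⇒ not `(ρ₁, …)`-deep). [this file] -/
theorem compressedMildCount_le_wild {ρ₁ : ℝ} (hρ : (12 : ℝ) ≤ ρ₁) (θ₁ : ℝ) (y : Fin N → EuclideanSpace ℝ (Fin 3)) :
    compressedMildCount ρ₁ θ₁ y ≤ wildRunCount 64 ρ₁ (1 / 10 ^ 4) (1 / 1000) (3 / 50) (1 / 450) 12 2 y :=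
  natCard_le_of_imp fun _ hj => ⟨hj.1.1, fun hA => hj.2 (Or.inr ⟨affDeepReg_of_radius_le hρ hA, hj.1.2.2⟩)⟩

/-- WEAKER side: «CompressedMild_W» ⟸ W_W(ρ₁) for `ρ₁ ≥ 12`. [this file] -/
theorem compressedMildW_of_wild {ρ₁ θ₁ σ₁ σ₂ : ℝ} (hρ : (12 : ℝ) ≤ ρ₁)
    (hX : BalancedWildRunGapW 64 ρ₁ (1 / 10 ^ 4) (1 / 1000) (3 / 50) (1 / 450) 12 2 σ₁ σ₂) : CompressedMildW ρ₁ θ₁ σ₁ σ₂ :=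
  censusW_mono (fun y => compressedMildCount_le_wild hρ θ₁ y) (fun _ => le_rfl) (balancedWildRunGapW_iff_censusW.1 hX)

/-! ## §5  Seams to the record -/

/-- **RunInterior_W ⟸ SW♭_W(ρ₁, θ₁) ∧ «CompressedMild_W» ∧ «HaloWild_W» ∧ «StrainCore_W» ∧ «RoughCore_W»** (`θ₁ ≥ 10⁻³`, `L ≥ 0`): the tree seam
`balancedRunInteriorGapW_of_swapFlatW` at tolerance `θ₀ := θ₁`, its compressed leaf by §4, its wild leaf by §3 («AbsorbedWild», KD♭ PROVED). [this file] -/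
theorem balancedRunInteriorGapW_of_shearSwapW {ρ₁ L θ₁ δ : ℝ} (hL : 0 ≤ L) (hθ : (1 / 1000 : ℝ) ≤ θ₁) (hδ : 0 < δ) (hδ2 : δ ≤ 2)
    (hT : StackSwapGainFlatW 64 ρ₁ (1 / 10 ^ 4) θ₁ (17 / 50) (17 / 20) (3 / 50) (1 / 450) 12 2 δ 2) (hC : CompressedMildW ρ₁ θ₁ δ 2)
    (hH : HaloWildW ρ₁ L θ₁ δ 2) (hS : StrainCoreW ρ₁ L θ₁ δ 2) (hR : RoughCoreW ρ₁ L θ₁ δ 2) :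
    BalancedRunInteriorGapW 64 (3 / 50) (1 / 450) 12 2 δ 2 :=
  balancedRunInteriorGapW_of_swapFlatW hδ hδ2 hT (balancedCompressedRunGapW_tol_of_mild hδ hδ2 hC)
    (balancedWildRunGapW_tol_of_cells hL hθ hδ hδ2 (absorbedWildW_record ρ₁ hδ hδ2) hH hS hR)

/-- **RunInterior ⟸ SW♭(ρ₁, θ₁) ∧ CompressedMild ∧ HaloWild ∧ StrainCore ∧ RoughCore.** [this file] -/
theorem runInterior_of_shearSwap {ρ₁ L θ₁ : ℝ} (hL : 0 ≤ L) (hθ : (1 / 1000 : ℝ) ≤ θ₁)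
    (hT : TameStackSwapGainFlat 64 ρ₁ (1 / 10 ^ 4) θ₁ (17 / 50) (17 / 20) (3 / 50) (1 / 450) 12 2) (hC : CompressedMild ρ₁ θ₁)
    (hH : HaloWild ρ₁ L θ₁) (hS : StrainCore ρ₁ L θ₁) (hR : RoughCore ρ₁ L θ₁) : RunInterior :=
  fun δ hδ hδ2 => balancedRunInteriorGapW_of_shearSwapW hL hθ hδ hδ2 (hT δ hδ hδ2) (hC δ hδ hδ2) (hH δ hδ hδ2) (hS δ hδ hδ2) (hR δ hδ hδ2)

/-- **InterfaceDominance ⟸ SW♭(ρ₁, θ₁) ∧ CompressedMild ∧ HaloWild ∧ StrainCore ∧ RoughCore ∧ ThinFault.** [this file] -/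
theorem interfaceDominance_of_shearSwap_thinFault {ρ₁ L θ₁ : ℝ} (hL : 0 ≤ L) (hθ : (1 / 1000 : ℝ) ≤ θ₁)
    (hT : TameStackSwapGainFlat 64 ρ₁ (1 / 10 ^ 4) θ₁ (17 / 50) (17 / 20) (3 / 50) (1 / 450) 12 2) (hC : CompressedMild ρ₁ θ₁)
    (hH : HaloWild ρ₁ L θ₁) (hS : StrainCore ρ₁ L θ₁) (hR : RoughCore ρ₁ L θ₁) (hF : ThinFault) : InterfaceDominance :=
  interfaceDominance_iff_runInterior_thinFault.2 ⟨runInterior_of_shearSwap hL hθ hT hC hH hS hR, hF⟩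

/-- At `ρ₁ = 12` the halo cell holds for free (empty count; the bulk floor from KD♭_W by `censusW_mono`). [this file] -/
theorem haloWild_twelve (L θ₁ : ℝ) : HaloWild 12 L θ₁ := by
  intro δ hδ hδ2
  have hK : CensusW (fun y => pricedCount 64 12 (1 / 10 ^ 4) (1 / 1000) (17 / 50) (17 / 20) (3 / 50) (1 / 450) δ y)
      (fun y => notDeepCount 64 (3 / 50) (1 / 450) y) δ 2 := compressedDeepAt_min hδ hδ2
  exact censusW_mono (fun y => by rw [haloWildCount_twelve]; exact Nat.zero_le _) (fun _ => le_rfl) hK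

/-- **Record radius: `WildRun ⟺ MildShear 12 L θ₁ ∧ StrainCore 12 L θ₁ ∧ RoughCore 12 L θ₁`** (halo empty), any `L ≥ 0`, any `θ₁`. [this file] -/
theorem wildRun_iff_cells {L θ₁ : ℝ} (hL : 0 ≤ L) : WildRun ↔ MildShear 12 L θ₁ ∧ StrainCore 12 L θ₁ ∧ RoughCore 12 L θ₁ := by
  rw [show WildRun ↔ _ from tameBalancedWildRunGap_iff_cells (ρ₁ := 12) (θ₁ := θ₁) hL]
  exact ⟨fun h => ⟨h.1, h.2.2⟩, fun h => ⟨h.1, haloWild_twelve L θ₁, h.2⟩⟩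

/-- **Wide radius: `WildRunWide ⟺ MildShear 24 ∧ HaloWild 24 ∧ StrainCore 24 ∧ RoughCore 24`.** [this file] -/
theorem wildRunWide_iff_cells {L θ₁ : ℝ} (hL : 0 ≤ L) :
    WildRunWide ↔ MildShear 24 L θ₁ ∧ HaloWild 24 L θ₁ ∧ StrainCore 24 L θ₁ ∧ RoughCore 24 L θ₁ :=
  tameBalancedWildRunGap_iff_cells hL

/-- **`WildRunWide30`** «RW₃₀» — the wild leaf at the (2c) programme's FINAL-in-practice radius `ρ₁ = 30` (census v55 R55). [this file · kind: statement ·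
WEAKER than HI · the TARGET of this node at ρ₁ = 30] -/
def WildRunWide30 : Prop :=
  TameBalancedWildRunGap 64 30 (1 / 10 ^ 4) (1 / 1000) (3 / 50) (1 / 450) 12 2

/-- **`WildRunWide30 ⟺ MildShear 30 ∧ HaloWild 30 ∧ StrainCore 30 ∧ RoughCore 30`.** [this file] -/
theorem wildRunWide30_iff_cells {L θ₁ : ℝ} (hL : 0 ≤ L) :
    WildRunWide30 ↔ MildShear 30 L θ₁ ∧ HaloWild 30 L θ₁ ∧ StrainCore 30 L θ₁ ∧ RoughCore 30 L θ₁ :=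
  tameBalancedWildRunGap_iff_cells hL

/-- **THE INSTANCE PROPOSED FOR THE RECORD: `(ρ₁, θ₁, L) = (30, 1/400, 64)`** —
`SW♭(30, 1/400) ∧ CompressedMild(30, 1/400) ∧ HaloWild ∧ StrainCore ∧ RoughCore ∧ ThinFault ⇒ InterfaceDominance`. [this file] -/
theorem interfaceDominance_of_wide30 (hT : TameStackSwapGainFlat 64 30 (1 / 10 ^ 4) (1 / 400) (17 / 50) (17 / 20) (3 / 50) (1 / 450) 12 2)
    (hC : CompressedMild 30 (1 / 400)) (hH : HaloWild 30 64 (1 / 400)) (hS : StrainCore 30 64 (1 / 400)) (hR : RoughCore 30 64 (1 / 400))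
    (hF : ThinFault) : InterfaceDominance :=
  interfaceDominance_of_shearSwap_thinFault (by norm_num) (by norm_num) hT hC hH hS hR hF

/-- **RDEF of record through the node** (slot-3 cone `rdef_of_ceg_shape_roughCut_record` BY NAME, its `InterfaceDominance` leaf from §5). [this file] -/
theorem rdef_of_ceg_shape_wildCut30_record
    (hCEG : Summit.AtomisticToContinuum.Crystallization.Theses.PricedLinkCensus.ChargedEnergyGap)
    (hSh : OverbindingBudgetTwoShellShape.TwoShellShape (1 / 100) (3 / 50) (1 / 450))
    (hQH : TameBalancedHexRoughGap 64 12 (1 / 10 ^ 5) (1 / 25) (3 / 50) (1 / 450) 12) (hQ : RoughCubic)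
    (hT : TameStackSwapGainFlat 64 30 (1 / 10 ^ 4) (1 / 400) (17 / 50) (17 / 20) (3 / 50) (1 / 450) 12 2)
    (hC : CompressedMild 30 (1 / 400)) (hH : HaloWild 30 64 (1 / 400)) (hS : StrainCore 30 64 (1 / 400)) (hR : RoughCore 30 64 (1 / 400))
    (hF : ThinFault)
    (hK : ∃ μ₁ μR : ℝ, 0 < μ₁ ∧ 0 < μR ∧ OverbindingBudgetAffineNearCluster.PureMarginStabilityAt (3 / 2000) μ₁ μR 4)
    (hA : AffineChartStraightening)
    (hE : OverbindingBudgetAffineNearCluster.NearLightSkeletonEquilibrium (3 / 2000) 4 6 (1 / 1000) 12 (1 / 25) (1 / 2000) 4 6 320 12)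
    (hCF : OverbindingBudgetAffineNearCluster.NearPricedCoreFloor (3 / 2000) 4 6 (1 / 1000) 12 (1 / 25) (1 / 2000) (1 / (4 * 10 ^ 7) / 4) 4 6 12)
    (hSF : OverbindingBudgetAffineNearCluster.NearPricedShellFloor (3 / 2000) 4 6 (1 / 1000) 12 (1 / 25) (1 / 2000) (1 / (4 * 10 ^ 7) / 4) 4 6 12)
    (hV : OverbindingBudgetAffineNearCluster.ForceContentVisible (3 / 2000) 4 6 (1 / 1000) 12 (1 / 25) (1 / 2000) 4 6)
    (hN : OverbindingBudgetAffineNearCluster.NearSecondOrderFloor (3 / 2000) 4 6 (1 / 1000) 12 (1 / 25) (1 / 2000) (1 / (4 * 10 ^ 7)))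
    (hFA : OverbindingBudgetAffineLocalisation.FarAggregatePricing 12 (1 / 25) (1 / 2000) (1 / (2 * 10 ^ 7)))
    (hFR : FineNonAffinity 12 (1 / 10 ^ 5) (1 / 25))
    (hTT : OverbindingBudgetGradedBareness.CleanlessExcessT) (hRR : OverbindingBudgetCoherentCut.CoherentResidual 10) :
    Summit.AtomisticToContinuum.Crystallization.Theses.OverbindingBudget.RobustDefectLimitWindows :=
  rdef_of_ceg_shape_roughCut_record hCEG hSh hQH hQ (interfaceDominance_of_wide30 hT hC hH hS hR hF) hK hA hE hCF hSF hV hN hFA hFR hTT hRR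

end Summit.AtomisticToContinuum.Crystallization.Theorems.OverbindingBudgetAffineWildCut
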